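import Summits.AnomalousDissipation.AnomalousDissipation.Theorems.MarginalStabilityChainBurgersLayerKHStubStrainedB

/-!
# Line `Sketch`, stub `stub_strained` (lead) — part C: the integration-by-parts estimate

`ibp_estimate`: for `α > 0` and `re λ ≥ ℓ > 0` there is `C⋆(α, ℓ)` with
`‖∫_{t>y} k_α(t-y) e^{αt} ou(ω)(t)/(λ+iU(t)) dt‖ ≤ C⋆ C_ω` for every Gaussian-class `C²` function `ω`
(`‖ω‖ ≤ C_ω e^{-t²/4}`, plus Gaussian-type decay of `ω'` and `ou α ω`, which only kill the boundary terms).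
This is the estimate that makes `T_h - T₀ = O(h)` in the weighted sup norm, i.e. the regularity of the
`h → 0` (infinite Reynolds number) limit of the slow-mode problem in the Gaussian class.  Proof: one
integration by parts in closed form — `φ·ou(ω) = (φω' - φ₁ω + tφω)' + (φ₂ - α²φ - tφ₁)ω` with `φ = A r`,
`φ₁ = φ'`, `φ₂ = φ₁'` — on `[y, Y]`, `Y → ∞`; `k_α(0) = 0` leaves the boundary term `e^{αy}ω(y)/(λ+iU(y))`.
-/

set_option linter.dupNamespace false

noncomputable section

open Complex MeasureTheory Filter Topology Set Metric intervalIntegral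

namespace Summit.AnomalousDissipation.AnomalousDissipation.Theorems.BurgersLayerKH.Sheet.Strained

/-- **The integration-by-parts estimate behind `T_h - T₀ = O(h)`.**  For `α > 0`, `re λ ≥ ℓ > 0`
there is `C⋆ = C⋆(α, ℓ)` such that for every Gaussian-class `C²` function `ω` (with Gaussian-type decay
of `ω'` and of `ou α ω`, which only serve to kill the boundary terms at `+∞`) and every `y`,
`‖∫_{t>y} k_α(t-y) e^{αt} ou(ω)(t)/(λ+iU(t)) dt‖ ≤ C⋆ · C_ω`, where `‖ω‖ ≤ C_ω e^{-t²/4}`: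
integrate by parts twice; `k_α(0) = 0` leaves the single boundary term `e^{αy} ω(y)/(λ+iU(y))`.
[folklore] -/
theorem ibp_estimate {α ℓ : ℝ} (hα : 0 < α) (hℓ : 0 < ℓ) : ∃ Cstar : ℝ, 0 ≤ Cstar ∧ ∀ (lam : ℂ), ℓ ≤ lam.re → ∀ (ω : ℝ → ℂ), ContDiff ℝ 2 ω → ∀ (Cω D D' : ℝ), GaussBound ω Cω → (∀ t, ‖deriv ω t‖ ≤ D * (1 + |t|) ^ 2 * Real.exp (-(t ^ 2) / 4)) → (∀ t, ‖ou α ω t‖ ≤ D' * (1 + |t|) * Real.exp (-(t ^ 2) / 4)) → ∀ y : ℝ, ‖∫ t in Ioi y, (volterraKernel α (t - y) : ℂ) * (Real.exp (α * t) : ℂ) * (ou α ω t / (lam + I * U t))‖ ≤ Cstar * Cω := by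
  obtain ⟨C₁, hC₁, hpeg⟩ := peg_setIntegral_bound 1 α
  -- the coefficient bound of `φ₂ - α² φ - t φ₁`
  set c₀ : ℝ := α / ℓ + 2 / ℓ ^ 2 + (1 / ℓ ^ 2 + 2 / ℓ ^ 3) / (2 * α) + 1 / ℓ + 1 / (2 * α * ℓ ^ 2)
    with hc₀
  have hc₀pos : 0 ≤ c₀ := by positivity
  refine ⟨Real.exp (α ^ 2) / ℓ + c₀ * C₁, by positivity, ?_⟩
  intro lam hlam ω hω Cω D D' hG hD hD' y
  have hlam0 : 0 < lam.re := hℓ.trans_le hlam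
  have hCω : 0 ≤ Cω := GaussBound.nonneg hG
  have hD0 : 0 ≤ D := by
    have := (norm_nonneg _).trans (hD 0); simpa using this
  have hne : ∀ t, lam + I * U t ≠ 0 := lam_add_ne_zero hlam0
  -- regularity of ω
  have hωd : Differentiable ℝ ω := hω.differentiable (by norm_num)
  have hω1 : ContDiff ℝ 1 (deriv ω) := (show ContDiff ℝ (1 + 1) ω from hω).deriv'
  have hωd' : Differentiable ℝ (deriv ω) := hω1.differentiable (by norm_num)
  have hω2c : Continuous (deriv (deriv ω)) := hω1.continuous_deriv le_rfl
  have hou : ∀ t, ou α ω t = deriv (deriv ω) t + (t : ℂ) * deriv ω t + (1 - (α : ℂ) ^ 2) * ω t := by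
    intro t; simp only [ou, iteratedDeriv_two_eq]
  have houc : Continuous (ou α ω) := by
    have : ou α ω = fun t => deriv (deriv ω) t + (t : ℂ) * deriv ω t + (1 - (α : ℂ) ^ 2) * ω t := funext hou
    rw [this]
    exact (hω2c.add (continuous_ofReal.mul hωd'.continuous)).add (continuous_const.mul hωd.continuous)
  -- the kernel pieces
  set k : ℝ → ℝ := fun t => (1 - Real.exp (-(2 * α * (t - y)))) / (2 * α) with hk
  have hkV : ∀ t, volterraKernel α (t - y) = k t := fun t => by rw [volterraKernel_of_ne hα.ne']
  set A : ℝ → ℝ := fun t => k t * Real.exp (α * t) with hA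
  set B : ℝ → ℝ := fun t => Real.exp (-(2 * α * (t - y))) * Real.exp (α * t) + α * k t * Real.exp (α * t)
    with hB
  set r : ℝ → ℂ := fun t => (lam + I * U t)⁻¹ with hr
  set r₁ : ℝ → ℂ := fun t => -(I * (Real.exp (-(t ^ 2) / 2) : ℂ)) / (lam + I * U t) ^ 2 with hr₁
  set r₂ : ℝ → ℂ := fun t => I * (t : ℂ) * (Real.exp (-(t ^ 2) / 2) : ℂ) / (lam + I * U t) ^ 2 -
      2 * (Real.exp (-(t ^ 2) / 2) : ℂ) ^ 2 / (lam + I * U t) ^ 3 with hr₂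
  have hAd : ∀ t, HasDerivAt A (B t) t := by
    intro t
    have := hasDerivAt_kerA hα.ne' y t
    simp only [hkV] at this
    exact this
  have hBd : ∀ t, HasDerivAt B (α ^ 2 * A t) t := by
    intro t
    have := hasDerivAt_kerB hα.ne' y t
    simp only [hkV] at this
    exact this
  have hrd : ∀ t, HasDerivAt r (r₁ t) t := fun t => hasDerivAt_kerR hlam0 t
  have hr₁d : ∀ t, HasDerivAt r₁ (r₂ t) t := fun t => hasDerivAt_kerR₁ hlam0 t
  -- φ, φ₁, φ₂
  set φ : ℝ → ℂ := fun t => (A t : ℂ) * r t with hφ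
  set φ₁ : ℝ → ℂ := fun t => (B t : ℂ) * r t + (A t : ℂ) * r₁ t with hφ₁
  set φ₂ : ℝ → ℂ := fun t => (((α ^ 2 * A t : ℝ) : ℂ) * r t + (B t : ℂ) * r₁ t) +
      ((B t : ℂ) * r₁ t + (A t : ℂ) * r₂ t) with hφ₂
  have hφd : ∀ t, HasDerivAt φ (φ₁ t) t := fun t => ((hAd t).ofReal_comp).mul (hrd t)
  have hφ₁d : ∀ t, HasDerivAt φ₁ (φ₂ t) t := fun t =>
    (((hBd t).ofReal_comp).mul (hrd t)).add (((hAd t).ofReal_comp).mul (hr₁d t))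
  -- continuity of the kernel pieces
  have hcc : Continuous fun t => lam + I * (U t : ℂ) := by
    have := differentiable_U.continuous; fun_prop
  have hrc : Continuous r := Continuous.inv₀ hcc hne
  have hEc : Continuous fun t : ℝ => (Real.exp (-(t ^ 2) / 2) : ℂ) := by fun_prop
  have hr₁c : Continuous r₁ := by
    refine Continuous.div (by fun_prop) (hcc.pow 2) fun t => pow_ne_zero _ (hne t)
  have hr₂c : Continuous r₂ := by
    refine Continuous.sub (Continuous.div (by fun_prop) (hcc.pow 2) fun t => pow_ne_zero _ (hne t))
      (Continuous.div (by fun_prop) (hcc.pow 3) fun t => pow_ne_zero _ (hne t))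
  have hAc : Continuous A := by simp only [hA, hk]; fun_prop
  have hBc : Continuous B := by simp only [hB, hk]; fun_prop
  have hφc : Continuous φ := (continuous_ofReal.comp hAc).mul hrc
  have hφ₁c : Continuous φ₁ := ((continuous_ofReal.comp hBc).mul hrc).add ((continuous_ofReal.comp hAc).mul hr₁c)
  have hφ₂c : Continuous φ₂ := by
    refine (((continuous_ofReal.comp (continuous_const.mul hAc)).mul hrc).add
      ((continuous_ofReal.comp hBc).mul hr₁c)).add
      (((continuous_ofReal.comp hBc).mul hr₁c).add ((continuous_ofReal.comp hAc).mul hr₂c))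
  -- sizes on `t ≥ y`
  have hksize : ∀ t, y ≤ t → 0 ≤ k t ∧ k t ≤ 1 / (2 * α) := by
    intro t ht
    have := volterraKernel_bounds hα (sub_nonneg.2 ht)
    rw [hkV] at this; exact this
  have hAsize : ∀ t, y ≤ t → ‖(A t : ℂ)‖ ≤ Real.exp (α * t) / (2 * α) := by
    intro t ht
    obtain ⟨h0, h1⟩ := hksize t ht
    rw [Complex.norm_real, Real.norm_eq_abs, hA]
    simp only
    rw [abs_of_nonneg (mul_nonneg h0 (Real.exp_pos _).le)]
    calc k t * Real.exp (α * t) ≤ 1 / (2 * α) * Real.exp (α * t) := by gcongr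
      _ = Real.exp (α * t) / (2 * α) := by ring
  have hBsize : ∀ t, y ≤ t → ‖(B t : ℂ)‖ ≤ Real.exp (α * t) := by
    intro t ht
    obtain ⟨h0, h1⟩ := hksize t ht
    have hq1 : Real.exp (-(2 * α * (t - y))) ≤ 1 := by
      rw [Real.exp_le_one_iff]; nlinarith
    have hq0 : 0 < Real.exp (-(2 * α * (t - y))) := Real.exp_pos _
    rw [Complex.norm_real, Real.norm_eq_abs, hB]
    simp only
    have hkq : α * k t = (1 - Real.exp (-(2 * α * (t - y)))) / 2 := by
      simp only [hk]; field_simp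
    rw [show Real.exp (-(2 * α * (t - y))) * Real.exp (α * t) + α * k t * Real.exp (α * t) =
      (Real.exp (-(2 * α * (t - y))) + α * k t) * Real.exp (α * t) by ring, hkq]
    rw [abs_of_nonneg (by positivity)]
    calc (Real.exp (-(2 * α * (t - y))) + (1 - Real.exp (-(2 * α * (t - y)))) / 2) * Real.exp (α * t)
        ≤ 1 * Real.exp (α * t) := by gcongr; linarith
      _ = Real.exp (α * t) := one_mul _
  have hrsize : ∀ t, ‖r t‖ ≤ 1 / ℓ ∧ ‖r₁ t‖ ≤ 1 / ℓ ^ 2 ∧ ‖r₂ t‖ ≤ 1 / ℓ ^ 2 + 2 / ℓ ^ 3 :=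
    fun t => kerR_bounds hℓ hlam t
  have hφsize : ∀ t, y ≤ t → ‖φ t‖ ≤ Real.exp (α * t) * (1 / (2 * α * ℓ)) := by
    intro t ht
    rw [hφ]; simp only; rw [norm_mul]
    calc ‖(A t : ℂ)‖ * ‖r t‖ ≤ Real.exp (α * t) / (2 * α) * (1 / ℓ) :=
          mul_le_mul (hAsize t ht) (hrsize t).1 (norm_nonneg _) (by positivity)
      _ = Real.exp (α * t) * (1 / (2 * α * ℓ)) := by field_simp
  have hφ₁size : ∀ t, y ≤ t → ‖φ₁ t‖ ≤ Real.exp (α * t) * (1 / ℓ + 1 / (2 * α * ℓ ^ 2)) := by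
    intro t ht
    rw [hφ₁]; simp only
    calc ‖(B t : ℂ) * r t + (A t : ℂ) * r₁ t‖ ≤ ‖(B t : ℂ)‖ * ‖r t‖ + ‖(A t : ℂ)‖ * ‖r₁ t‖ := by
          rw [← norm_mul, ← norm_mul]; exact norm_add_le _ _
      _ ≤ Real.exp (α * t) * (1 / ℓ) + Real.exp (α * t) / (2 * α) * (1 / ℓ ^ 2) :=
          add_le_add (mul_le_mul (hBsize t ht) (hrsize t).1 (norm_nonneg _) (by positivity))
            (mul_le_mul (hAsize t ht) (hrsize t).2.1 (norm_nonneg _) (by positivity))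
      _ = Real.exp (α * t) * (1 / ℓ + 1 / (2 * α * ℓ ^ 2)) := by field_simp
  have hφ₂size : ∀ t, y ≤ t → ‖φ₂ t‖ ≤
      Real.exp (α * t) * (α / (2 * ℓ) + 2 / ℓ ^ 2 + (1 / ℓ ^ 2 + 2 / ℓ ^ 3) / (2 * α)) := by
    intro t ht
    rw [hφ₂]; simp only
    have h1 : ‖((α ^ 2 * A t : ℝ) : ℂ) * r t‖ ≤ α ^ 2 * (Real.exp (α * t) / (2 * α)) * (1 / ℓ) := by
      rw [norm_mul, Complex.ofReal_mul, norm_mul]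
      refine mul_le_mul (by
        rw [Complex.norm_real, Real.norm_eq_abs, abs_of_nonneg (sq_nonneg α)]
        exact mul_le_mul_of_nonneg_left (hAsize t ht) (sq_nonneg α)) (hrsize t).1 (norm_nonneg _)
        (by positivity)
    have h2 : ‖(B t : ℂ) * r₁ t‖ ≤ Real.exp (α * t) * (1 / ℓ ^ 2) := by
      rw [norm_mul]; exact mul_le_mul (hBsize t ht) (hrsize t).2.1 (norm_nonneg _) (by positivity)
    have h3 : ‖(A t : ℂ) * r₂ t‖ ≤ Real.exp (α * t) / (2 * α) * (1 / ℓ ^ 2 + 2 / ℓ ^ 3) := by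
      rw [norm_mul]; exact mul_le_mul (hAsize t ht) (hrsize t).2.2 (norm_nonneg _) (by positivity)
    calc ‖((α ^ 2 * A t : ℝ) : ℂ) * r t + (B t : ℂ) * r₁ t + ((B t : ℂ) * r₁ t + (A t : ℂ) * r₂ t)‖
        ≤ (‖((α ^ 2 * A t : ℝ) : ℂ) * r t‖ + ‖(B t : ℂ) * r₁ t‖) + (‖(B t : ℂ) * r₁ t‖ + ‖(A t : ℂ) * r₂ t‖) :=
          (norm_add_le _ _).trans (add_le_add (norm_add_le _ _) (norm_add_le _ _))
      _ ≤ (α ^ 2 * (Real.exp (α * t) / (2 * α)) * (1 / ℓ) + Real.exp (α * t) * (1 / ℓ ^ 2)) +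
            (Real.exp (α * t) * (1 / ℓ ^ 2) + Real.exp (α * t) / (2 * α) * (1 / ℓ ^ 2 + 2 / ℓ ^ 3)) :=
          add_le_add (add_le_add h1 h2) (add_le_add h2 h3)
      _ = Real.exp (α * t) * (α / (2 * ℓ) + 2 / ℓ ^ 2 + (1 / ℓ ^ 2 + 2 / ℓ ^ 3) / (2 * α)) := by
          field_simp; ring
  -- the remainder `R` and the boundary function
  set R : ℝ → ℂ := fun t => (φ₂ t - (α : ℂ) ^ 2 * φ t - (t : ℂ) * φ₁ t) * ω t with hR
  set Bd : ℝ → ℂ := fun t => φ t * deriv ω t - φ₁ t * ω t + (t : ℂ) * φ t * ω t with hBd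
  set Bd' : ℝ → ℂ := fun t => φ t * deriv (deriv ω) t + (t : ℂ) * φ t * deriv ω t + φ t * ω t -
      φ₂ t * ω t + (t : ℂ) * φ₁ t * ω t with hBd'
  have hBdd : ∀ t, HasDerivAt Bd (Bd' t) t := by
    intro t
    have h1 := (hφd t).mul (hωd' t).hasDerivAt
    have h2 := (hφ₁d t).mul (hωd t).hasDerivAt
    have h3 := (((hasDerivAt_id' t).ofReal_comp.mul (hφd t)).mul (hωd t).hasDerivAt)
    have := (h1.sub h2).add h3
    refine this.congr_deriv ?_
    simp only [hBd', Pi.mul_apply]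
    push_cast
    ring
  have hident : ∀ t, φ t * ou α ω t = Bd' t + R t := by
    intro t; simp only [hou, hBd', hR]; ring
  have hRc : Continuous R := ((hφ₂c.sub (continuous_const.mul hφc)).sub (continuous_ofReal.mul hφ₁c)).mul
    hωd.continuous
  have hLc : Continuous fun t => φ t * ou α ω t := hφc.mul houc
  have hBd'c : Continuous Bd' := by
    have : Bd' = fun t => φ t * ou α ω t - R t := by funext t; rw [hident t]; ring
    rw [this]; exact hLc.sub hRc
  -- sizes of `R`, of the integrand and of the boundary function on `t ≥ y`
  have hRsize : ∀ t, y ≤ t → ‖R t‖ ≤ (c₀ * Cω) * ((1 + |t|) ^ 1 * Real.exp (α * t) * Real.exp (-(t ^ 2) / 4)) := by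
    intro t ht
    have ht0 : 0 ≤ |t| := abs_nonneg t
    have hE0 : 0 < Real.exp (α * t) := Real.exp_pos _
    have hcoef : ‖φ₂ t - (α : ℂ) ^ 2 * φ t - (t : ℂ) * φ₁ t‖ ≤ c₀ * (1 + |t|) * Real.exp (α * t) := by
      calc ‖φ₂ t - (α : ℂ) ^ 2 * φ t - (t : ℂ) * φ₁ t‖
          ≤ ‖φ₂ t‖ + ‖(α : ℂ) ^ 2 * φ t‖ + ‖(t : ℂ) * φ₁ t‖ := by
            calc _ ≤ ‖φ₂ t - (α : ℂ) ^ 2 * φ t‖ + ‖(t : ℂ) * φ₁ t‖ := norm_sub_le _ _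
              _ ≤ ‖φ₂ t‖ + ‖(α : ℂ) ^ 2 * φ t‖ + ‖(t : ℂ) * φ₁ t‖ := by gcongr; exact norm_sub_le _ _
        _ ≤ Real.exp (α * t) * (α / (2 * ℓ) + 2 / ℓ ^ 2 + (1 / ℓ ^ 2 + 2 / ℓ ^ 3) / (2 * α)) +
              α ^ 2 * (Real.exp (α * t) * (1 / (2 * α * ℓ))) +
              |t| * (Real.exp (α * t) * (1 / ℓ + 1 / (2 * α * ℓ ^ 2))) := by
            refine add_le_add (add_le_add (hφ₂size t ht) ?_) ?_
            · rw [norm_mul, norm_pow, Complex.norm_real, Real.norm_eq_abs, sq_abs]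
              exact mul_le_mul_of_nonneg_left (hφsize t ht) (sq_nonneg α)
            · rw [norm_mul, Complex.norm_real, Real.norm_eq_abs]
              exact mul_le_mul_of_nonneg_left (hφ₁size t ht) ht0
        _ ≤ c₀ * (1 + |t|) * Real.exp (α * t) := by
            have hα2 : α ^ 2 * (Real.exp (α * t) * (1 / (2 * α * ℓ))) = Real.exp (α * t) * (α / (2 * ℓ)) := by
              field_simp
            rw [hα2]
            have hP : 0 ≤ (α / (2 * ℓ) + 2 / ℓ ^ 2 + (1 / ℓ ^ 2 + 2 / ℓ ^ 3) / (2 * α) + α / (2 * ℓ)) * |t| *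
                Real.exp (α * t) + (1 / ℓ + 1 / (2 * α * ℓ ^ 2)) * Real.exp (α * t) := by positivity
            have e : c₀ * (1 + |t|) * Real.exp (α * t) =
                (Real.exp (α * t) * (α / (2 * ℓ) + 2 / ℓ ^ 2 + (1 / ℓ ^ 2 + 2 / ℓ ^ 3) / (2 * α)) +
                  Real.exp (α * t) * (α / (2 * ℓ)) + |t| * (Real.exp (α * t) * (1 / ℓ + 1 / (2 * α * ℓ ^ 2)))) +
                ((α / (2 * ℓ) + 2 / ℓ ^ 2 + (1 / ℓ ^ 2 + 2 / ℓ ^ 3) / (2 * α) + α / (2 * ℓ)) * |t| *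
                  Real.exp (α * t) + (1 / ℓ + 1 / (2 * α * ℓ ^ 2)) * Real.exp (α * t)) := by
              rw [hc₀]; ring
            rw [e]; linarith
    rw [hR]; simp only; rw [norm_mul, pow_one]
    calc ‖φ₂ t - (α : ℂ) ^ 2 * φ t - (t : ℂ) * φ₁ t‖ * ‖ω t‖
        ≤ (c₀ * (1 + |t|) * Real.exp (α * t)) * (Cω * Real.exp (-(t ^ 2) / 4)) :=
          mul_le_mul hcoef (hG t) (norm_nonneg _) (by positivity)
      _ = (c₀ * Cω) * ((1 + |t|) * Real.exp (α * t) * Real.exp (-(t ^ 2) / 4)) := by ring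
  have hLsize : ∀ t, y ≤ t → ‖φ t * ou α ω t‖ ≤
      (D' / (2 * α * ℓ)) * ((1 + |t|) ^ 1 * Real.exp (α * t) * Real.exp (-(t ^ 2) / 4)) := by
    intro t ht
    rw [norm_mul, pow_one]
    calc ‖φ t‖ * ‖ou α ω t‖ ≤ (Real.exp (α * t) * (1 / (2 * α * ℓ))) * (D' * (1 + |t|) * Real.exp (-(t ^ 2) / 4)) :=
          mul_le_mul (hφsize t ht) (hD' t) (norm_nonneg _) (by positivity)
      _ = (D' / (2 * α * ℓ)) * ((1 + |t|) * Real.exp (α * t) * Real.exp (-(t ^ 2) / 4)) := by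
          field_simp
  have hBdsize : ∀ t, y ≤ t → ‖Bd t‖ ≤ (D / (2 * α * ℓ) + Cω * (1 / ℓ + 1 / (2 * α * ℓ ^ 2)) + Cω / (2 * α * ℓ)) *
      ((1 + |t|) ^ 2 * Real.exp (α * t) * Real.exp (-(t ^ 2) / 4)) := by
    intro t ht
    have ht0 : 0 ≤ |t| := abs_nonneg t
    have hp1 : (1 : ℝ) ≤ (1 + |t|) ^ 2 := by nlinarith
    have hp2 : |t| ≤ (1 + |t|) ^ 2 := by nlinarith
    have hE0 : 0 < Real.exp (α * t) := Real.exp_pos _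
    have hG0 : 0 < Real.exp (-(t ^ 2) / 4) := Real.exp_pos _
    rw [hBd]; simp only
    have h1 : ‖φ t * deriv ω t‖ ≤ (D / (2 * α * ℓ)) * ((1 + |t|) ^ 2 * Real.exp (α * t) * Real.exp (-(t ^ 2) / 4)) := by
      rw [norm_mul]
      calc ‖φ t‖ * ‖deriv ω t‖ ≤ (Real.exp (α * t) * (1 / (2 * α * ℓ))) * (D * (1 + |t|) ^ 2 * Real.exp (-(t ^ 2) / 4)) :=
            mul_le_mul (hφsize t ht) (hD t) (norm_nonneg _) (by positivity)
        _ = (D / (2 * α * ℓ)) * ((1 + |t|) ^ 2 * Real.exp (α * t) * Real.exp (-(t ^ 2) / 4)) := by field_simp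
    have h2 : ‖φ₁ t * ω t‖ ≤ (Cω * (1 / ℓ + 1 / (2 * α * ℓ ^ 2))) * ((1 + |t|) ^ 2 * Real.exp (α * t) * Real.exp (-(t ^ 2) / 4)) := by
      rw [norm_mul]
      calc ‖φ₁ t‖ * ‖ω t‖ ≤ (Real.exp (α * t) * (1 / ℓ + 1 / (2 * α * ℓ ^ 2))) * (Cω * Real.exp (-(t ^ 2) / 4)) :=
            mul_le_mul (hφ₁size t ht) (hG t) (norm_nonneg _) (by positivity)
        _ = (Cω * (1 / ℓ + 1 / (2 * α * ℓ ^ 2))) * (1 * Real.exp (α * t) * Real.exp (-(t ^ 2) / 4)) := by ring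
        _ ≤ (Cω * (1 / ℓ + 1 / (2 * α * ℓ ^ 2))) * ((1 + |t|) ^ 2 * Real.exp (α * t) * Real.exp (-(t ^ 2) / 4)) := by
            gcongr
    have h3 : ‖(t : ℂ) * φ t * ω t‖ ≤ (Cω / (2 * α * ℓ)) * ((1 + |t|) ^ 2 * Real.exp (α * t) * Real.exp (-(t ^ 2) / 4)) := by
      rw [norm_mul, norm_mul, Complex.norm_real, Real.norm_eq_abs]
      calc |t| * ‖φ t‖ * ‖ω t‖ ≤ |t| * (Real.exp (α * t) * (1 / (2 * α * ℓ))) * (Cω * Real.exp (-(t ^ 2) / 4)) := by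
            gcongr
            · exact hφsize t ht
            · exact hG t
        _ = (Cω / (2 * α * ℓ)) * (|t| * Real.exp (α * t) * Real.exp (-(t ^ 2) / 4)) := by field_simp
        _ ≤ (Cω / (2 * α * ℓ)) * ((1 + |t|) ^ 2 * Real.exp (α * t) * Real.exp (-(t ^ 2) / 4)) := by gcongr
    calc ‖φ t * deriv ω t - φ₁ t * ω t + (t : ℂ) * φ t * ω t‖
        ≤ ‖φ t * deriv ω t‖ + ‖φ₁ t * ω t‖ + ‖(t : ℂ) * φ t * ω t‖ := by
          calc _ ≤ ‖φ t * deriv ω t - φ₁ t * ω t‖ + ‖(t : ℂ) * φ t * ω t‖ := norm_add_le _ _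
            _ ≤ _ := by gcongr; exact norm_sub_le _ _
      _ ≤ _ := by
          have := add_le_add (add_le_add h1 h2) h3
          refine this.trans (le_of_eq ?_); ring
  -- integrability on `(y, ∞)` and the limits
  obtain ⟨hLint, -⟩ := hpeg (fun t => φ t * ou α ω t) hLc (D' / (2 * α * ℓ)) y hLsize
  obtain ⟨hRint, hRbound⟩ := hpeg R hRc (c₀ * Cω) y hRsize
  have hBd0 : Tendsto Bd atTop (𝓝 0) := tendsto_zero_of_peg' hBdsize
  -- FTC on `[y, Y]`
  have hFTC : ∀ Y, ∫ t in y..Y, φ t * ou α ω t = (Bd Y - Bd y) + ∫ t in y..Y, R t := by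
    intro Y
    have e1 : ∫ t in y..Y, φ t * ou α ω t = ∫ t in y..Y, (Bd' t + R t) := by
      congr 1; funext t; exact hident t
    rw [e1, intervalIntegral.integral_add (hBd'c.intervalIntegrable _ _) (hRc.intervalIntegrable _ _),
      intervalIntegral.integral_eq_sub_of_hasDerivAt (fun t _ => hBdd t) (hBd'c.intervalIntegrable _ _)]
  have hlim1 : Tendsto (fun Y => ∫ t in y..Y, φ t * ou α ω t) atTop (𝓝 (∫ t in Ioi y, φ t * ou α ω t)) :=
    intervalIntegral_tendsto_integral_Ioi y hLint tendsto_id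
  have hlim2 : Tendsto (fun Y => (Bd Y - Bd y) + ∫ t in y..Y, R t) atTop
      (𝓝 ((0 - Bd y) + ∫ t in Ioi y, R t)) :=
    (hBd0.sub_const _).add (intervalIntegral_tendsto_integral_Ioi y hRint tendsto_id)
  have hEq : (∫ t in Ioi y, φ t * ou α ω t) = (0 - Bd y) + ∫ t in Ioi y, R t :=
    tendsto_nhds_unique (hlim1.congr hFTC) hlim2
  -- the boundary term at `y`
  have hky : k y = 0 := by simp [hk]
  have hAy : A y = 0 := by simp [hA, hky]
  have hBy : B y = Real.exp (α * y) := by simp [hB, hky]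
  have hBdy : Bd y = -((Real.exp (α * y) : ℂ) * r y * ω y) := by
    simp only [hBd, hφ, hφ₁, hAy, hBy]
    push_cast
    ring
  -- rewrite the target integrand as `φ · ou`
  have hI : (∫ t in Ioi y, (volterraKernel α (t - y) : ℂ) * (Real.exp (α * t) : ℂ) * (ou α ω t / (lam + I * U t))) =
      ∫ t in Ioi y, φ t * ou α ω t := by
    congr 1; funext t
    simp only [hφ, hA, hr, hkV]; push_cast; rw [div_eq_mul_inv]; ring
  rw [hI, hEq, hBdy]
  -- final bound
  have hb1 : ‖(0 : ℂ) - -((Real.exp (α * y) : ℂ) * r y * ω y)‖ ≤ Real.exp (α ^ 2) / ℓ * Cω := by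
    rw [zero_sub, neg_neg, norm_mul, norm_mul, Complex.norm_real, Real.norm_of_nonneg (Real.exp_pos _).le]
    calc Real.exp (α * y) * ‖r y‖ * ‖ω y‖ ≤ Real.exp (α * y) * (1 / ℓ) * (Cω * Real.exp (-(y ^ 2) / 4)) := by
          gcongr
          · exact (hrsize y).1
          · exact hG y
      _ = (Real.exp (α * y) * Real.exp (-(y ^ 2) / 4)) * Cω / ℓ := by ring
      _ ≤ Real.exp (α ^ 2) * Cω / ℓ := by gcongr; exact exp_lin_gauss_le α y
      _ = Real.exp (α ^ 2) / ℓ * Cω := by ring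
  have hb2 : ‖∫ t in Ioi y, R t‖ ≤ c₀ * C₁ * Cω := by
    calc ‖∫ t in Ioi y, R t‖ ≤ |c₀ * Cω| * C₁ := hRbound
      _ = c₀ * C₁ * Cω := by rw [abs_of_nonneg (mul_nonneg hc₀pos hCω)]; ring
  calc ‖(0 : ℂ) - -((Real.exp (α * y) : ℂ) * r y * ω y) + ∫ t in Ioi y, R t‖
      ≤ ‖(0 : ℂ) - -((Real.exp (α * y) : ℂ) * r y * ω y)‖ + ‖∫ t in Ioi y, R t‖ := norm_add_le _ _
    _ ≤ Real.exp (α ^ 2) / ℓ * Cω + c₀ * C₁ * Cω := add_le_add hb1 hb2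
    _ = (Real.exp (α ^ 2) / ℓ + c₀ * C₁) * Cω := by ring

end Summit.AnomalousDissipation.AnomalousDissipation.Theorems.BurgersLayerKH.Sheet.Strained

end
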